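import Summits.CriticalPhenomena.SAWScalingLimit.Theorems.SAWTotalPositivityCriticalBubbleBoundJoinMacroDoor
import Summits.CriticalPhenomena.SAWScalingLimit.Theorems.SAWTotalPositivityCriticalBubbleBoundJoinBigEntropy
import Summits.CriticalPhenomena.SAWScalingLimit.Theorems.SAWTotalPositivityCriticalBubbleBoundJoinMacroTermwise
import Summits.CriticalPhenomena.SAWScalingLimit.Theorems.SAWTotalPositivityCriticalBubbleBoundJoinBigTermwise

/-!
# The doors of the join-mass programme in uniform-`SAP_N` (TERMWISE) language
(crux `SAWTotalPositivity.CriticalBubbleBound`, stmt-CriticalPhenomena-7117; line `docking-census-joining`, lead prover c8)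

Eight lead seats reduced the crux `G_{x_c}(0,e₀) < ∞` on `ℤ²` (Madras–Slade's open problem) to exponent statements
about the uniform self-avoiding polygon of given length; this file records the two HEADLINE reductions in exactly the
length-by-length form in which they are measured numerically, as glue over the landed doors:

* `criticalBubbleBound_of_termwise_rarity` — ONE knob: if for some `π > 1/2` the lex-rooted classes of every walk
  length `n - 17`, `n ∈ B_{i+1}`, carry on (uniform) average at most `C (i+1)^b 2^{-π i}` MACROSCOPIC GLOBAL join
  plaquettes, then `CriticalBubbleBound` (`joinMacroRarity_of_termwise` p159867, then the macroscopic door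
  `criticalBubbleBound_of_joinMacroRarity` p157993 with Hammond's entropy `κ = 3/2`);
* `criticalBubbleBound_of_termwise_size_rarity` — TWO knobs: a size fraction (`max (height, width) ≥ 2^{ν' i}` for a
  fixed fraction of the classes of every length of block `i`, all large `i`) and a rarity bound with exponents
  `0 < ν'`, `1 < ν' + π` (`bigMassFraction_of_termwise` p159791, `joinMacroRarity_of_termwise`, two-knob door p158694).

Status of the hypotheses (2026-08-17): rarity proved only at `π = 0` (sharp for unrestricted global join plaquettes —
ears), heuristic `11/16`, measured `0.69–0.72`; size free for every `ν' < 1/2` (p162083), false for every `ν' > 1`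
(p162378), heuristic `ν = 3/4`. No conjecture is asserted here.

Source: A. Hammond, *An upper bound on the number of self-avoiding polygons via joining*, Ann. Probab. 46 (2018), §4.
-/

noncomputable section

open Literature.Probability.LatticeModels
open Literature.Probability.RandomPlanarGeometry Literature.Probability.RandomPlanarGeometry.SAW
open scoped BigOperators
open Summit.CriticalPhenomena.SAWScalingLimit.Theorems.CriticalBubbleBound.Negative (e₀)
open Summit.CriticalPhenomena.SAWScalingLimit.Theorems.CriticalBubbleBound.Docking

namespace Summit.CriticalPhenomena.SAWScalingLimit.Theorems.CriticalBubbleBound.Join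

/-- **What closes the crux, termwise (one knob).** If for some `π > 1/2` the uniform self-avoiding polygons of
`ℤ²` carry, length by length along the dyadic blocks, on average at most `C (i+1)^b 2^{-π i}` MACROSCOPIC GLOBAL join
plaquettes (`Σ_{χ ∈ lexRooted (n-17)} #mjoins χ ≤ C (i+1)^b 2^{-π i} · #lexRooted (n-17)` for `n ∈ B_{i+1}`, `n ≥ 17`),
then `G_{x_c}(0,e₀) < ∞` (`CriticalBubbleBound`). Glue: `joinMacroRarity_of_termwise` then
`criticalBubbleBound_of_joinMacroRarity` (Hammond's entropy `κ = 3/2`). Heuristic exponent `11/16`, measured `0.69–0.72`;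
needed `> 1/2`; proved `0`. (Registered sub-goal of the crux item; the hypothesis is the open knob, NOT asserted.)
[cite: Hammond2015SAPJoining, §4] -/
theorem criticalBubbleBound_of_termwise_rarity : ∀ (π b C : ℝ), 1 / 2 < π → (∀ i : ℕ, ∀ n ∈ block (i + 1), joinShift ≤ n → ∑ χ ∈ lexRooted (n - joinShift), ((mjoins (n - joinShift) χ).card : ℝ) ≤ C * ((i : ℝ) + 1) ^ b * (2 : ℝ) ^ (-π * (i : ℝ)) * ((lexRooted (n - joinShift)).card : ℝ)) → Summit.CriticalPhenomena.SAWScalingLimit.Theses.SAWTotalPositivity.CriticalBubbleBound := by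
  intro π b C hπ h
  exact criticalBubbleBound_of_joinMacroRarity π hπ (joinMacroRarity_of_termwise π b C h)

open Classical in
/-- **What closes the crux, termwise (two knobs).** If for some exponents `0 < ν'`, `1 < ν' + π`: (size) for all large
`i` a fixed fraction `c > 0` of the classes of every length of block `i` has `max (height, width) ≥ 2^{ν' i}`, and (rarity)
the average number of macroscopic global join plaquettes is `≤ C (i+1)^b 2^{-π i}` length by length on block `i+1`, then
`CriticalBubbleBound`. Glue: `bigMassFraction_of_termwise`, `joinMacroRarity_of_termwise`, two-knob door
`criticalBubbleBound_of_bigMassFraction_of_joinMacroRarity`. Registered instance `(ν', π) = (5/8, 1/2)`; the size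
hypothesis is free for `ν' < 1/2` (`bigMassFraction_of_lt_half`) and false for `ν' > 1` (`not_bigMassFraction_of_one_lt`).
(Registered sub-goal of the crux item; hypotheses are the open knobs, NOT asserted.) [cite: Hammond2015SAPJoining, §4] -/
theorem criticalBubbleBound_of_termwise_size_rarity : ∀ (ν' π c b C : ℝ), 0 < ν' → 1 < ν' + π → 0 < c → (∃ i₀ : ℕ, ∀ i : ℕ, i₀ ≤ i → ∀ n ∈ block i, joinShift ≤ n → c * ((lexRooted (n - joinShift)).card : ℝ) ≤ (((lexRooted (n - joinShift)).filter fun χ => IsBigAt ν' i (n - joinShift) χ).card : ℝ)) → (∀ i : ℕ, ∀ n ∈ block (i + 1), joinShift ≤ n → ∑ χ ∈ lexRooted (n - joinShift), ((mjoins (n - joinShift) χ).card : ℝ) ≤ C * ((i : ℝ) + 1) ^ b * (2 : ℝ) ^ (-π * (i : ℝ)) * ((lexRooted (n - joinShift)).card : ℝ)) → Summit.CriticalPhenomena.SAWScalingLimit.Theses.SAWTotalPositivity.CriticalBubbleBound := by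
  intro ν' π c b C hν hsum hc hsize hrar
  exact criticalBubbleBound_of_bigMassFraction_of_joinMacroRarity ν' π hν hsum
    (bigMassFraction_of_termwise ν' c hc hsize) (joinMacroRarity_of_termwise π b C hrar)

end Summit.CriticalPhenomena.SAWScalingLimit.Theorems.CriticalBubbleBound.Join

end
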